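import Mathlib
import HarnessLib
import Summits.Ventures.LatticeQCDFlow.Scaling.PlaquetteTopLinkOrders
import Summits.Ventures.LatticeQCDFlow.Scaling.PlaquetteIndependence2D

/-!
# LatticeQCDFlow / Scaling — the comb: on the two-dimensional torus the top-link obstruction is a
# single plaquette (all plaquettes but one admit a one-plaquette autoregressive structure)

HONEST FRAMING: exact (Metropolis-corrected) sampling algorithms for lattice gauge theory;
figures of merit are autocorrelation/cost numbers at stated couplings and volumes; no
continuum-physics claim.

Venture `LatticeQCDFlow` (cell pub-lqcd), topic `Scaling`, FANOUT row 30 (lean-1, GEN-23) — OUR WORK on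
THEORY-2.md §4 row C5 (autoregressive context).  `Scaling/PlaquetteTopLinkOrders` §2 shows that on the
periodic lattice at least ONE plaquette is bad for every injective top-link assignment and every
generation order; §4 turns a peeling rank into a compatible order.  Here, in two dimensions, the
lower bound is attained: the COMB — top links for the plaquettes of the rows `x₁ ≠ −1`, ranked by the
row; right links for the plaquettes of the last row `x₁ = −1`, ranked `L + x₀` — is a peeling rank on
ALL plaquettes of `(ℤ/L)²` but the corner `(−1, −1)`, so there is a generation order of all links along
which every plaquette except the corner is generated by its own one-plaquette conditioner.  With
`Scaling/AutoregressiveGaugeHeatBathTorusTauInt` (any `B`, `k = #Bᶜ`): once the heat-bath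
autoregression of this ranked non-rectangular complex is shown exact (the tree has rectangles only,
`Scaling/AutoregressiveGaugeHeatBathExact2D`), the exact sampler of the periodic two-dimensional
target has `τ_int ≤ M/m − 1/2` UNIFORMLY IN THE VOLUME.  `L ≥ 2`.

## What is proved (all [ours])

* `val_add_one_of_ne_neg_one` — `(z + 1).val = z.val + 1` for `z ≠ −1` in `ZMod L` [folklore]; the
  uniqueness of the plane in two dimensions is `Theory2.Lattice.TwoDim.plane_eq_zero_one`
  (`Scaling/PlaquetteIndependence2D`).
* **`exists_comb_order`** — `L ≥ 2`: an injective top-link assignment `t` (`t p` a link of `p`) and a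
  duplicate-free list of ALL links of `(ℤ/L)²` along which every plaquette other than the corner
  `(−1, −1)` has all its links `e' ≠ t p` strictly before `t p`.

Pure lattice combinatorics.  No `def`, no `sorry`, nothing cited as a fact.
-/

namespace Summit.Ventures.LatticeQCDFlow.Theory2.Autoregressive

open Literature.MathematicalPhysics.QuantumFieldTheory
open Summit.Ventures.LatticeQCDFlow.Theory2.Lattice.TwoDim

/-- `(z + 1).val = z.val + 1` in `ZMod L` unless `z = −1`. [folklore] -/
theorem val_add_one_of_ne_neg_one {L : ℕ} [NeZero L] (hL : 2 ≤ L) {z : ZMod L} (hz : z ≠ -1) :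
    (z + 1).val = z.val + 1 := by
  haveI : Fact (1 < L) := ⟨hL⟩
  have hlt : z.val < L := ZMod.val_lt z
  have hne : z.val + 1 ≠ L := by
    intro h
    apply hz
    have h1 : z + 1 = 0 := by
      rw [← ZMod.val_eq_zero, ZMod.val_add, ZMod.val_one, h, Nat.mod_self]
    exact eq_neg_of_add_eq_zero_left h1
  rw [ZMod.val_add, ZMod.val_one, Nat.mod_eq_of_lt (by omega)]

/-- **The comb.**  `L ≥ 2`.  There are an injective assignment `t` of a link `t p ∈ p` to every
plaquette of `(ℤ/L)²` and a duplicate-free list `l` of ALL links such that every plaquette other than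
the corner `q₀ = ((−1, −1); 0, 1)` has all its links `e' ≠ t p` strictly before `t p` in `l` — the
lower bound «at least one bad plaquette» of `Scaling/PlaquetteTopLinkOrders.exists_plaquette_topLink_not_last`
is attained in two dimensions.  (`t`: the top link `(x + e₁, 0)` when `x₁ ≠ −1`, the right link
`(x + e₀, 1)` on the last row; rank `x₁.val`, resp. `L + x₀.val`.) [ours] -/
theorem exists_comb_order {L : ℕ} [NeZero L] (hL : 2 ≤ L) :
    ∃ (t : Plaquette 2 L → Edge 2 L) (l : List (Edge 2 L)),
      Function.Injective t ∧
      (∀ p : Plaquette 2 L, t p ∈ ({(p.1, p.2.1.1), (p.1.shift p.2.1.1, p.2.1.2),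
        (p.1.shift p.2.1.2, p.2.1.1), (p.1, p.2.1.2)} : Finset (Edge 2 L))) ∧
      l.Nodup ∧ (∀ e : Edge 2 L, e ∈ l) ∧
      ∀ p : Plaquette 2 L, p ≠ ((![-1, -1] : Site 2 L), ⟨((0 : Fin 2), (1 : Fin 2)), by decide⟩) →
        ∀ e' ∈ ({(p.1, p.2.1.1), (p.1.shift p.2.1.1, p.2.1.2),
          (p.1.shift p.2.1.2, p.2.1.1), (p.1, p.2.1.2)} : Finset (Edge 2 L)),
        e' ≠ t p → l.idxOf e' < l.idxOf (t p) := by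
  classical
  haveI : Fact (1 < L) := ⟨hL⟩
  -- the comb assignment and its rank
  set t : Plaquette 2 L → Edge 2 L := fun p =>
    if p.1 1 = -1 then (p.1.shift 0, 1) else (p.1.shift 1, 0) with ht
  set rank : Plaquette 2 L → ℕ := fun p =>
    if p.1 1 = -1 then L + (p.1 0).val else (p.1 1).val with hrank
  set q₀ : Plaquette 2 L := ((![-1, -1] : Site 2 L), ⟨((0 : Fin 2), (1 : Fin 2)), by decide⟩) with hq₀
  -- shifts are injective
  have hshift_inj : ∀ (x y : Site 2 L) (i : Fin 2), x.shift i = y.shift i → x = y := by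
    intro x y i h; simpa [Site.shift] using h
  -- coordinates of shifts
  have hs0_1 : ∀ x : Site 2 L, (x.shift 0) 1 = x 1 := fun x => by simp [Site.shift]
  have hs0_0 : ∀ x : Site 2 L, (x.shift 0) 0 = x 0 + 1 := fun x => by simp [Site.shift]
  have hs1_1 : ∀ x : Site 2 L, (x.shift 1) 1 = x 1 + 1 := fun x => by simp [Site.shift]
  have hs1_0 : ∀ x : Site 2 L, (x.shift 1) 0 = x 0 := fun x => by simp [Site.shift]
  -- injectivity of `t`
  have htinj : Function.Injective t := by
    intro p p' h
    obtain ⟨x, q⟩ := p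
    obtain ⟨x', q'⟩ := p'
    have hq := plane_eq_zero_one q
    have hq' := plane_eq_zero_one q'
    subst hq; subst hq'
    simp only [ht] at h
    split_ifs at h with h1 h2 h2
    · exact Prod.ext (hshift_inj x x' 0 (congrArg Prod.fst h)) rfl
    · have h2 : (1 : Fin 2) = 0 := congrArg Prod.snd h
      exact absurd h2 (by decide)
    · have h2 : (0 : Fin 2) = 1 := congrArg Prod.snd h
      exact absurd h2 (by decide)
    · exact Prod.ext (hshift_inj x x' 1 (congrArg Prod.fst h)) rfl
  -- `t p` is a link of `p`
  have htmem : ∀ p : Plaquette 2 L, t p ∈ ({(p.1, p.2.1.1), (p.1.shift p.2.1.1, p.2.1.2),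
      (p.1.shift p.2.1.2, p.2.1.1), (p.1, p.2.1.2)} : Finset (Edge 2 L)) := by
    intro p
    obtain ⟨x, q⟩ := p
    have hq := plane_eq_zero_one q
    subst hq
    simp only [ht]
    split_ifs <;> simp
  -- the peeling rank on `B = univ.erase q₀`
  have hrk : ∀ p ∈ (Finset.univ.erase q₀), ∀ p' ∈ (Finset.univ.erase q₀), p ≠ p' →
      t p ∈ ({(p'.1, p'.2.1.1), (p'.1.shift p'.2.1.1, p'.2.1.2),
        (p'.1.shift p'.2.1.2, p'.2.1.1), (p'.1, p'.2.1.2)} : Finset (Edge 2 L)) → rank p < rank p' := by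
    intro p hp p' hp' hne hmem
    obtain ⟨x, q⟩ := p
    obtain ⟨x', q'⟩ := p'
    have hq := plane_eq_zero_one q
    have hq' := plane_eq_zero_one q'
    subst hq; subst hq'
    simp only [Finset.mem_insert, Finset.mem_singleton, ht] at hmem
    by_cases hrow : x 1 = -1
    · -- last row: `t p = (x + e₀, 1)`; it is the left link of the plaquette to the right
      rw [if_pos hrow] at hmem
      rcases hmem with h | h | h | h
      · have h2 : (1 : Fin 2) = 0 := congrArg Prod.snd h
        exact absurd h2 (by decide)
      · -- `(x+e₀, 1) = (x'+e₀, 1)` ⇒ same plaquette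
        exact (hne (Prod.ext (hshift_inj x x' 0 (congrArg Prod.fst h)) rfl)).elim
      · have h2 : (1 : Fin 2) = 0 := congrArg Prod.snd h
        exact absurd h2 (by decide)
      · -- `x + e₀ = x'` : the plaquette to the right, on the last row
        have hx' : x' = x.shift 0 := (congrArg Prod.fst h).symm
        have hx0 : x 0 ≠ -1 := by
          intro h0
          apply Finset.ne_of_mem_erase hp
          refine Prod.ext ?_ rfl
          ext k; fin_cases k
          · simpa [hq₀] using h0
          · simpa [hq₀] using hrow
        have hr1 : rank (x, ⟨((0 : Fin 2), (1 : Fin 2)), by decide⟩) = L + (x 0).val := by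
          simp only [hrank, if_pos hrow]
        have hr2 : rank (x', ⟨((0 : Fin 2), (1 : Fin 2)), by decide⟩) = L + (x 0 + 1).val := by
          simp only [hrank, hx', hs0_1, hs0_0, if_pos hrow]
        rw [hr1, hr2, val_add_one_of_ne_neg_one hL hx0]
        omega
    · -- other rows: `t p = (x + e₁, 0)`; it is the bottom link of the plaquette above
      rw [if_neg hrow] at hmem
      rcases hmem with h | h | h | h
      · -- `x + e₁ = x'`
        have hx' : x' = x.shift 1 := (congrArg Prod.fst h).symm
        have hval : (x' 1).val = (x 1).val + 1 := by
          rw [hx', hs1_1, val_add_one_of_ne_neg_one hL hrow]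
        have hr1 : rank (x, ⟨((0 : Fin 2), (1 : Fin 2)), by decide⟩) = (x 1).val := by
          simp only [hrank, if_neg hrow]
        rw [hr1]
        by_cases hrow' : x' 1 = -1
        · have hr2 : rank (x', ⟨((0 : Fin 2), (1 : Fin 2)), by decide⟩) = L + (x' 0).val := by
            simp only [hrank, if_pos hrow']
          rw [hr2]; have := ZMod.val_lt (x 1); omega
        · have hr2 : rank (x', ⟨((0 : Fin 2), (1 : Fin 2)), by decide⟩) = (x' 1).val := by
            simp only [hrank, if_neg hrow']
          rw [hr2]; omega
      · have h2 : (0 : Fin 2) = 1 := congrArg Prod.snd h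
        exact absurd h2 (by decide)
      · exact (hne (Prod.ext (hshift_inj x x' 1 (congrArg Prod.fst h)) rfl)).elim
      · have h2 : (0 : Fin 2) = 1 := congrArg Prod.snd h
        exact absurd h2 (by decide)
  obtain ⟨l, hnd, hall, hgood⟩ := exists_order_of_topLink_rank (Finset.univ.erase q₀) t
    (htinj.injOn) rank hrk
  refine ⟨t, l, htinj, htmem, hnd, hall, fun p hp e' he' hne => ?_⟩
  exact hgood p (Finset.mem_erase.2 ⟨hp, Finset.mem_univ _⟩) e' he' hne

end Summit.Ventures.LatticeQCDFlow.Theory2.Autoregressive
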